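import Summits.Ventures.CertifiedArithmetic.LowPrec.Attain
import Summits.Ventures.CertifiedArithmetic.LowPrec.FormatsP3109

/-!
# Corollary E1-attain for the P3109 / FNUZ 8-bit formats

HONEST FRAMING (venture CertifiedArithmetic / cell `pub-lowprec`): certified error envelopes and
provably optimal rounding/accumulation schemes for low-precision formats under stated cost models;
every table by two implementations; no hardware or vendor claims.

The sharp normal-range relative error `u/(1+u)` of round-to-nearest is attained by a product of
two same-format data iff `2^P + 1` has a factor pair of `P`-bit significands (THEOREMS-R1
Corollary E1-attain; [JeannerodRump2018, Thm 3.2] for the general criterion; `Attain.lean` for the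
never-attained direction when `2^P + 1` is prime). For the P3109 precisions among the enum's held
keys: `P = 4` (`binary8p4`, both domains; FNUZ E4M3): `17` prime ⇒ NEVER attained
(`Binary8p4_errMul_lt_sharp`, `Binary8p4F_errMul_lt_sharp`, all `254²`/`256²` pairs, no
enumeration); `P = 3` (`binary8p3`, FNUZ E5M2): `9 = 3·3`, witness `3/2 · 3/2 = 9/4 ↦ 2`, relative
error exactly `1/9`; `P = 5` (`binary8p5`): `33 = 3·11`, witness `3/2 · 11/8 = 33/16 ↦ 2`, relative
error exactly `1/33` — the enum's pre-registered constants for these keys (kernel evaluations).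
-/

namespace Literature.ComputerArithmetic.FloatingPoint

namespace MiniFloat

open Format

/-- `binary8p4` (Extended; `P = 4`, `17` prime): no product of two data attains `u/(1+u) = 1/17`
in the normal range. -/
theorem Binary8p4_errMul_lt_sharp (a b : MiniFloat Binary8p4)
    (hlo : 2 ^ Binary8p4.manBits * Binary8p4.quantum ≤ |a.toRat * b.toRat|)
    (hhi : |a.toRat * b.toRat| ≤ Binary8p4.maxRat) :
    |errMul Binary8p4 a b| < Binary8p4.unitRoundoff / (1 + Binary8p4.unitRoundoff) * |a.toRat * b.toRat| :=
  abs_errMul_lt_sharp_of_prime (by decide) a b hlo hhi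

/-- `binary8p4` Finite domain (= FNUZ E4M3 as a value set; `P = 4`): never attains `1/17`. -/
theorem Binary8p4F_errMul_lt_sharp (a b : MiniFloat Binary8p4F)
    (hlo : 2 ^ Binary8p4F.manBits * Binary8p4F.quantum ≤ |a.toRat * b.toRat|)
    (hhi : |a.toRat * b.toRat| ≤ Binary8p4F.maxRat) :
    |errMul Binary8p4F a b| <
      Binary8p4F.unitRoundoff / (1 + Binary8p4F.unitRoundoff) * |a.toRat * b.toRat| :=
  abs_errMul_lt_sharp_of_prime (by decide) a b hlo hhi

/-- `binary8p3` (`P = 3`, `u/(1+u) = 1/9`): ATTAINED — `3/2 · 3/2 = 9/4` rounds (tie, to even) to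
`2`, error `1/4 = (1/9)·(9/4)`. Witness codes: exponent field `16`, trailing significand `2`. -/
theorem Binary8p3_errMul_sharp_attained :
    ∃ a b : MiniFloat Binary8p3, a.toRat * b.toRat = 9 / 4 ∧
      |errMul Binary8p3 a b| =
        Binary8p3.unitRoundoff / (1 + Binary8p3.unitRoundoff) * |a.toRat * b.toRat| :=
  ⟨⟨false, 16, 2, by decide, by decide, by decide⟩, ⟨false, 16, 2, by decide, by decide, by decide⟩,
    by decide +kernel, by decide +kernel⟩

/-- `binary8p3` Finite domain (= FNUZ E5M2 as a value set): the same witness attains `1/9`. -/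
theorem Binary8p3F_errMul_sharp_attained :
    ∃ a b : MiniFloat Binary8p3F, a.toRat * b.toRat = 9 / 4 ∧
      |errMul Binary8p3F a b| =
        Binary8p3F.unitRoundoff / (1 + Binary8p3F.unitRoundoff) * |a.toRat * b.toRat| :=
  ⟨⟨false, 16, 2, by decide, by decide, by decide⟩, ⟨false, 16, 2, by decide, by decide, by decide⟩,
    by decide +kernel, by decide +kernel⟩

/-- `binary8p5` (`P = 5`, `u/(1+u) = 1/33`, `33 = 3 · 11`): ATTAINED — `3/2 · 11/8 = 33/16` rounds
(tie, to even) to `2`, error `1/16 = (1/33)·(33/16)`. Witness codes: exponent field `4`, trailing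
significands `8` and `6`. -/
theorem Binary8p5_errMul_sharp_attained :
    ∃ a b : MiniFloat Binary8p5, a.toRat * b.toRat = 33 / 16 ∧
      |errMul Binary8p5 a b| =
        Binary8p5.unitRoundoff / (1 + Binary8p5.unitRoundoff) * |a.toRat * b.toRat| :=
  ⟨⟨false, 4, 8, by decide, by decide, by decide⟩, ⟨false, 4, 6, by decide, by decide, by decide⟩,
    by decide +kernel, by decide +kernel⟩

/-- The sharp constants themselves: `u/(1+u) = 1/9` (`binary8p3`), `1/17` (`binary8p4`),
`1/33` (`binary8p5`). -/
theorem Binary8p_sharp_constants :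
    Binary8p3.unitRoundoff / (1 + Binary8p3.unitRoundoff) = 1 / 9 ∧
    Binary8p4.unitRoundoff / (1 + Binary8p4.unitRoundoff) = 1 / 17 ∧
    Binary8p5.unitRoundoff / (1 + Binary8p5.unitRoundoff) = 1 / 33 := by
  decide +kernel

end MiniFloat

end Literature.ComputerArithmetic.FloatingPoint
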